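import Mathlib.LinearAlgebra.Matrix.GeneralLinearGroup.Defs
import Mathlib.LinearAlgebra.Matrix.Trace
import Mathlib.Data.Matrix.Block
import Mathlib.Data.ZMod.Basic
import HarnessLib

/-!
# The Faltings–Serre method after Brumer–Pacetti–Poor–Tornaría–Voight–Yuen, I: deviation cocycles

Typed skeleton (definitions and the elementary, PROVED matrix identities) of §2.3 of
[BPPTVY] = A. Brumer, A. Pacetti, C. Poor, G. Tornaría, J. Voight, D. S. Yuen, *On the paramodularity
of typical abelian surfaces*, Algebra & Number Theory **13** (2019) 1145–1195 [cite: BrumerEtAl2019],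
arXiv:1805.10873; page references below are to the arXiv version (held: `paper:arxiv-1805.10873`).

Fix a group `Γ` (in [BPPTVY]: `Gal_{F,S}`), a commutative ring `k` (there: `𝔽_ℓ`) and a homomorphism
`ρ̄ : Γ → GL_n(k)` (there: the common residual representation `ρ̄ = ρ̄₁ = ρ̄₂`, p. 1153).

* `IsDeviationCocycle ρ̄ μ` — [BPPTVY, (2.3.2) p. 1153]: `μ : Γ → M_n(k)` with
  `μ(στ) = μ(σ) + ρ̄(σ) μ(τ) ρ̄(σ)⁻¹`, i.e. `μ ∈ Z¹(Γ, ad ρ̄)`; the group `H¹(F, ad ρ̄; 𝔤(𝔽_ℓ))` of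
  loc. cit. is the set of such `μ` with values in the Lie algebra `𝔤(𝔽_ℓ) ≤ M_n(𝔽_ℓ)`.
* `IsDeviationCoboundary ρ̄ μ` — [BPPTVY, (2.3.3) p. 1153]: `μ(σ) = a - ρ̄(σ) a ρ̄(σ)⁻¹` for some `a ∈ M_n(k)`
  (the subgroup `B¹(F, ad ρ̄; M_n(𝔽_ℓ))`; NB loc. cit. allows `a ∈ M_n`, not only `a ∈ 𝔤`).
* `affineEmbed a g = [[g, a g], [0, g]]` — the embedding `M_n ⋊ GL_n ↪ GL_{2n}`,
  `(a, g) ↦ (1 a; 0 1)(g 0; 0 g) = (g ag; 0 g)` [BPPTVY, (2.3.9) pp. 1153–1154].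
* `utr` — "the trace of the upper right `n × n` block" [BPPTVY, p. 1154, before Lemma 2.3.11].
* `extensionMap ρ̄ μ σ = affineEmbed (μ σ) (ρ̄ σ) = [[ρ̄σ, μ(σ)ρ̄(σ)], [0, ρ̄σ]]` — the map `φ_μ` of
  [BPPTVY, (2.3.13) p. 1154].
* `IsObstructing ρ̄ μ` — [BPPTVY, Def. 2.3.18 p. 1155]: "`(L, φ)` is obstructing if `utr φ ≢ 0 (mod ℓ)`";
  by `utr_extensionMap`, `utr φ_μ(σ) = tr(μ(σ) ρ̄(σ))`, so we take `∃ σ, tr(μ σ ρ̄ σ) ≠ 0` as the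
  definition and prove the equality with the upper trace.
* `spLie J = {a | aᵀ J + J a = 0}` — [BPPTVY, (5.1.2) p. 1173]: `𝔰𝔭₄(𝔽₂) = {A ∈ M₄(𝔽₂) : Aᵀ J + J A = 0} ≃ 𝔽₂^10`;
  `gspLie J = {a | ∃ c, aᵀ J + J a = c • J}` (Lie algebra of `GSp(J)`).

PROVED here (all elementary): Lemma 2.3.11 (`utr` is invariant under conjugation by the affine group,
`utr_conj_affineEmbed`), Prop. 2.3.14(a) (`φ_μ` is multiplicative iff the cocycle identity,
`extensionMap_mul`), the direction (⇒) of Prop. 2.3.14(b)/Cor. 2.3.19 used in Algorithm 2.4.1 (a coboundary is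
never obstructing, `not_isObstructing_of_isDeviationCoboundary`), and a recorded DIVERGENCE from the
printed text: [BPPTVY, Lemma 2.3.20 / Remark 2.4.2, p. 1156] pass from `𝔤` to the trace-zero part `𝔤⁰`, and
(5.1.2) asserts `𝔤⁰(GSp₄)(𝔽₂) = 𝔰𝔭₄(𝔽₂)`; but in characteristic `2` every element of `𝔤𝔰𝔭₄(𝔽₂)` has
trace `0` (`diag(1,1,0,0) ∈ 𝔤𝔰𝔭₄(𝔽₂) ∖ 𝔰𝔭₄(𝔽₂)` has trace `0`: `gspLie_ne_spLie_char_two`), so the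
reduction to `𝔰𝔭₄(𝔽₂)`-valued cocycles must instead be justified by the equality of the SIMILITUDE
characters of `ρ₁, ρ₂` (both the cyclotomic character, [BPPTVY, (4.1.3) p. 1164 and Thm. 4.3.4(ii) p. 1169]); this is how
the criterion is typed in `Literature/NumberTheory/FaltingsSerre/Criterion.lean`.

Nothing here is specific to number fields: the Galois theory (fixed fields `K`, `L`, Def. 2.3.17) enters
only in `Criterion.lean` / `ParamodularCertificate.lean` as hypotheses on finite sets of group elements.

## References

* [BPPTVY] Brumer–Pacetti–Poor–Tornaría–Voight–Yuen, ANT 13:5 (2019) 1145–1195, §2.3 pp. 1153–1156, (4.1.3) p. 1164, Thm. 4.3.4 p. 1169, §5.1 (5.1.2) p. 1173 (PRINTED numbering and pages throughout this file).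
  [cite: BrumerEtAl2019]
* J.-P. Serre, *Résumé des cours de 1984–1985*, Œuvres IV, no. 135 (the original method);
  R. Livné, *Cubic exponential sums and Galois representations*, Contemp. Math. 67 (1987), §4
  [cite: Livne1987] (the case `ℓ = 2`).
-/

namespace Literature.NumberTheory.FaltingsSerre

open Matrix

section Affine

variable {n : Type*} [Fintype n] [DecidableEq n] {k : Type*} [CommRing k]

/-- The embedding `M_n ⋊ GL_n ↪ GL_{2n}`, `(a, g) ↦ (1 a; 0 1)·(g 0; 0 g) = (g ag; 0 g)`, on points
(stated for all `g ∈ M_n(k)`; [BPPTVY] take `g ∈ GL_n`). [cite: BrumerEtAl2019, (2.3.9) pp. 1153–1154] -/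
def affineEmbed (a g : Matrix n n k) : Matrix (n ⊕ n) (n ⊕ n) k :=
  Matrix.fromBlocks g (a * g) 0 g

/-- `utr : M_{2n}(k) → k`, "the trace of the upper right `n × n`-block". [cite: BrumerEtAl2019, p. 1154 (before Lemma 2.3.11)] -/
def utr (M : Matrix (n ⊕ n) (n ⊕ n) k) : k :=
  Matrix.trace (M.toBlocks₁₂)

omit [DecidableEq n] in
/-- `utr (g ag; 0 g) = tr(a g)`. [cite: BrumerEtAl2019, (2.3.12) p. 1154] -/
@[simp] theorem utr_affineEmbed (a g : Matrix n n k) : utr (affineEmbed a g) = Matrix.trace (a * g) := by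
  simp [utr, affineEmbed]

omit [DecidableEq n] in
/-- `utr` is additive. [folklore] -/
theorem utr_add (M N : Matrix (n ⊕ n) (n ⊕ n) k) : utr (M + N) = utr M + utr N := by
  simp only [utr]
  rw [← Matrix.trace_add]
  rfl

omit [DecidableEq n] in
/-- Multiplication in the affine group: `(h bh; 0 h)(g ag; 0 g) = (hg, (hag + bhg); 0, hg)`, i.e.
`(b,h)·(a,g) = (h a h⁻¹ + b, h g)` when `h` is invertible. [cite: BrumerEtAl2019, (2.3.9)–(2.3.12) pp. 1153–1154] -/
theorem affineEmbed_mul_affineEmbed (a b g h : Matrix n n k) :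
    affineEmbed b h * affineEmbed a g = Matrix.fromBlocks (h * g) (h * (a * g) + b * h * g) 0 (h * g) := by
  simp only [affineEmbed, Matrix.fromBlocks_multiply, Matrix.mul_zero, Matrix.zero_mul, add_zero,
    zero_add, Matrix.mul_assoc]

/-- The affine embedding of an invertible pair is invertible, with inverse `(-(h⁻¹ b h), h⁻¹)`:
`(h bh; 0 h)·(h⁻¹, -h⁻¹ b; 0, h⁻¹) = 1`. [cite: BrumerEtAl2019, proof of Lemma 2.3.11 p. 1154] -/
theorem affineEmbed_mul_affineEmbed_inv (b : Matrix n n k) (h : (Matrix n n k)ˣ) :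
    affineEmbed b (h : Matrix n n k) *
      affineEmbed (-(((h⁻¹ : (Matrix n n k)ˣ) : Matrix n n k) * b * (h : Matrix n n k)))
        ((h⁻¹ : (Matrix n n k)ˣ) : Matrix n n k) = 1 := by
  have h1 : (h : Matrix n n k) * ((h⁻¹ : (Matrix n n k)ˣ) : Matrix n n k) = 1 := Units.mul_inv h
  rw [affineEmbed_mul_affineEmbed]
  have e : (h : Matrix n n k) * (-(((h⁻¹ : (Matrix n n k)ˣ) : Matrix n n k) * b * (h : Matrix n n k)) *
      ((h⁻¹ : (Matrix n n k)ˣ) : Matrix n n k)) + b * (h : Matrix n n k) * ((h⁻¹ : (Matrix n n k)ˣ) : Matrix n n k) = 0 := by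
    simp only [Matrix.neg_mul, Matrix.mul_neg, Matrix.mul_assoc, h1, Matrix.mul_one, Units.mul_inv_cancel_left]
    exact neg_add_cancel b
  rw [e, h1, Matrix.fromBlocks_one]

/-- The inverse pair also multiplies to `1` on the other side. [cite: BrumerEtAl2019, proof of Lemma 2.3.11 p. 1154] -/
theorem affineEmbed_inv_mul_affineEmbed (b : Matrix n n k) (h : (Matrix n n k)ˣ) :
    affineEmbed (-(((h⁻¹ : (Matrix n n k)ˣ) : Matrix n n k) * b * (h : Matrix n n k)))
        ((h⁻¹ : (Matrix n n k)ˣ) : Matrix n n k) * affineEmbed b (h : Matrix n n k) = 1 := by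
  have h1' : ((h⁻¹ : (Matrix n n k)ˣ) : Matrix n n k) * (h : Matrix n n k) = 1 := Units.inv_mul h
  rw [affineEmbed_mul_affineEmbed]
  have e : ((h⁻¹ : (Matrix n n k)ˣ) : Matrix n n k) * (b * (h : Matrix n n k)) +
      -(((h⁻¹ : (Matrix n n k)ˣ) : Matrix n n k) * b * (h : Matrix n n k)) *
        ((h⁻¹ : (Matrix n n k)ˣ) : Matrix n n k) * (h : Matrix n n k) = 0 := by
    simp only [Matrix.neg_mul, Matrix.mul_assoc, Units.mul_inv_cancel_left, add_neg_cancel]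
  rw [e, h1', Matrix.fromBlocks_one]

/-- **[BPPTVY, Lemma 2.3.11]: the upper trace `utr` is well defined on conjugacy classes of the affine
group `(M_n ⋊ GL_n)(k)`.**  Conjugating `(g ag; 0 g)` by `(h bh; 0 h)` gives upper-right block
`hagh⁻¹ + bhgh⁻¹ - hgh⁻¹b`, whose trace is `tr(ag)`. [cite: BrumerEtAl2019, Lemma 2.3.11 and (2.3.12) p. 1154] -/
theorem utr_conj_affineEmbed (a g b : Matrix n n k) (h : (Matrix n n k)ˣ) :
    utr (affineEmbed b (h : Matrix n n k) * affineEmbed a g *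
        affineEmbed (-(((h⁻¹ : (Matrix n n k)ˣ) : Matrix n n k) * b * (h : Matrix n n k)))
          ((h⁻¹ : (Matrix n n k)ˣ) : Matrix n n k)) = utr (affineEmbed a g) := by
  have h1 : (h : Matrix n n k) * ((h⁻¹ : (Matrix n n k)ˣ) : Matrix n n k) = 1 := Units.mul_inv h
  rw [utr_affineEmbed, affineEmbed_mul_affineEmbed, affineEmbed, Matrix.fromBlocks_multiply]
  simp only [utr, Matrix.toBlocks_fromBlocks₁₂]
  -- upper-right block: `hg · (-(h⁻¹ b h) h⁻¹) + (h a g + b h g) · h⁻¹`; normalise products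
  simp only [Matrix.neg_mul, Matrix.mul_neg, Matrix.add_mul, Matrix.mul_assoc, h1, Matrix.mul_one,
    Matrix.trace_add, Matrix.trace_neg]
  -- `tr(h (a (g h⁻¹))) = tr(a g)`, and the two `b`-terms are cyclic rotations of each other
  rw [Matrix.trace_mul_comm (h : Matrix n n k) (a * (g * ((h⁻¹ : (Matrix n n k)ˣ) : Matrix n n k))),
    Matrix.trace_mul_comm b ((h : Matrix n n k) * (g * ((h⁻¹ : (Matrix n n k)ˣ) : Matrix n n k)))]
  simp only [Matrix.mul_assoc, Units.inv_mul, Matrix.mul_one]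
  ring

end Affine

section Cocycle

variable {Γ : Type*} [Group Γ] {n : Type*} [Fintype n] [DecidableEq n] {k : Type*} [CommRing k]

/-- `μ : Γ → M_n(k)` is a **deviation cocycle** for `ρ̄ : Γ → GL_n(k)` (a `1`-cocycle for the adjoint
representation `σ_μ(a) = ρ̄(σ) a ρ̄(σ)⁻¹`): `μ(στ) = μ(σ) + ρ̄(σ) μ(τ) ρ̄(σ)⁻¹`.  In [BPPTVY] the
cocycle attached to `ρ₁ ≡ ρ₂ (mod ℓ^r)` is `ρ₁(σ) ≡ (1 + ℓ^r μ(σ)) ρ₂(σ) (mod ℓ^{r+1})` (2.3.5), and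
Lemma 2.3.6(a) is the statement that it satisfies this identity. [cite: BrumerEtAl2019, (2.3.2), (2.3.5) and Lemma 2.3.6(a) p. 1153] -/
def IsDeviationCocycle (ρbar : Γ →* GL n k) (μ : Γ → Matrix n n k) : Prop :=
  ∀ σ τ, μ (σ * τ) = μ σ + (ρbar σ : Matrix n n k) * μ τ * ((ρbar σ)⁻¹ : GL n k)

/-- `μ` is a **deviation coboundary**: `μ(σ) = a - ρ̄(σ) a ρ̄(σ)⁻¹` for some `a ∈ M_n(k)`
(the subgroup `B¹(F, ad ρ̄; M_n(𝔽_ℓ))`; by Lemma 2.3.6(b), `ρ₁ ≃ ρ₂ (mod ℓ^{r+1})` iff the deviation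
cocycle is a coboundary). [cite: BrumerEtAl2019, (2.3.3) and Lemma 2.3.6(b) p. 1153] -/
def IsDeviationCoboundary (ρbar : Γ →* GL n k) (μ : Γ → Matrix n n k) : Prop :=
  ∃ a : Matrix n n k, ∀ σ, μ σ = a - (ρbar σ : Matrix n n k) * a * ((ρbar σ)⁻¹ : GL n k)

/-- The map `φ_μ : Γ → (M_n ⋊ GL_n)(k) ≤ GL_{2n}(k)`, `σ ↦ (ρ̄σ, μ(σ)ρ̄σ; 0, ρ̄σ)`. [cite: BrumerEtAl2019, (2.3.13) p. 1154] -/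
def extensionMap (ρbar : Γ →* GL n k) (μ : Γ → Matrix n n k) (σ : Γ) : Matrix (n ⊕ n) (n ⊕ n) k :=
  affineEmbed (μ σ) (ρbar σ : Matrix n n k)

/-- `utr φ_μ(σ) = tr(μ(σ) ρ̄(σ))` — the quantity of [BPPTVY, (2.3.15)]:
`utr φ_μ(σ) = tr(μ(σ)ρ̄(σ)) ≡ (tr ρ₁(σ) - tr ρ₂(σ)) / ℓ^r (mod ℓ)`. [cite: BrumerEtAl2019, Prop. 2.3.14(c) and (2.3.15) pp. 1154–1155] -/
@[simp] theorem utr_extensionMap (ρbar : Γ →* GL n k) (μ : Γ → Matrix n n k) (σ : Γ) :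
    utr (extensionMap ρbar μ σ) = Matrix.trace (μ σ * (ρbar σ : Matrix n n k)) :=
  utr_affineEmbed _ _

/-- **[BPPTVY, Prop. 2.3.14(a)]**: for a deviation cocycle, `φ_μ` is multiplicative (the upper right entry
of `φ_μ(στ)` is `μ(στ)ρ̄(στ) = μ(σ)ρ̄(σ)ρ̄(τ) + ρ̄(σ)μ(τ)ρ̄(τ)`). [cite: BrumerEtAl2019, Prop. 2.3.14(a) p. 1154] -/
theorem extensionMap_mul {ρbar : Γ →* GL n k} {μ : Γ → Matrix n n k} (hμ : IsDeviationCocycle ρbar μ)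
    (σ τ : Γ) : extensionMap ρbar μ (σ * τ) = extensionMap ρbar μ σ * extensionMap ρbar μ τ := by
  rw [extensionMap, extensionMap, extensionMap, affineEmbed_mul_affineEmbed, affineEmbed, hμ σ τ, map_mul,
    Units.val_mul]
  congr 1
  simp only [Matrix.add_mul, Matrix.mul_assoc, Units.inv_mul_cancel_left]
  rw [add_comm]

/-- `φ_μ(1) = 1` for a deviation cocycle (`μ(1) = μ(1) + μ(1)` forces `μ(1) = 0`). [cite: BrumerEtAl2019, Prop. 2.3.14(a) p. 1154] -/
theorem IsDeviationCocycle.apply_one {ρbar : Γ →* GL n k} {μ : Γ → Matrix n n k}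
    (hμ : IsDeviationCocycle ρbar μ) : μ 1 = 0 := by
  have h := hμ 1 1
  rw [mul_one, map_one, inv_one, Units.val_one, Matrix.one_mul, Matrix.mul_one] at h
  have : μ 1 + μ 1 = μ 1 + 0 := by rw [add_zero]; exact h.symm
  exact add_left_cancel this

/-- **[BPPTVY, Prop. 2.3.14(a)]**: `φ_μ` as a monoid homomorphism `Γ →* M_{2n}(k)` (its values are
invertible, `φ_μ(σ)⁻¹ = φ_μ(σ⁻¹)`), with `π ∘ φ_μ = ρ̄` (the diagonal blocks). [cite: BrumerEtAl2019, Prop. 2.3.14(a) p. 1154] -/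
def extensionHom {ρbar : Γ →* GL n k} {μ : Γ → Matrix n n k} (hμ : IsDeviationCocycle ρbar μ) :
    Γ →* Matrix (n ⊕ n) (n ⊕ n) k where
  toFun := extensionMap ρbar μ
  map_one' := by
    rw [extensionMap, hμ.apply_one, affineEmbed, map_one, Units.val_one, Matrix.mul_one,
      Matrix.fromBlocks_one]
  map_mul' := extensionMap_mul hμ

/-- `μ` is **obstructing** (for `ρ̄`): `utr φ_μ ≢ 0`, i.e. some `σ` has `tr(μ(σ) ρ̄(σ)) ≠ 0`; such a `σ`
is an *obstructing element*. [BPPTVY, Def. 2.3.18]: "A pair `(L, φ)` extending `(K, ρ̄)` is obstructing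
if `utr φ ≢ 0 (mod ℓ)` … An element `σ ∈ Gal(L | F)` such that `utr φ(σ) ≢ 0 (mod ℓ)` is called
obstructing for `φ`." [cite: BrumerEtAl2019, Def. 2.3.18 p. 1155] -/
def IsObstructing (ρbar : Γ →* GL n k) (μ : Γ → Matrix n n k) : Prop :=
  ∃ σ, Matrix.trace (μ σ * (ρbar σ : Matrix n n k)) ≠ 0

/-- `σ` is an **obstructing element** for `μ`. [cite: BrumerEtAl2019, Def. 2.3.18 p. 1155] -/
def IsObstructingElt (ρbar : Γ →* GL n k) (μ : Γ → Matrix n n k) (σ : Γ) : Prop :=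
  Matrix.trace (μ σ * (ρbar σ : Matrix n n k)) ≠ 0

/-- Unfolding: obstructing means some element is obstructing. [cite: BrumerEtAl2019, Def. 2.3.18 p. 1155] -/
theorem isObstructing_iff (ρbar : Γ →* GL n k) (μ : Γ → Matrix n n k) :
    IsObstructing ρbar μ ↔ ∃ σ, IsObstructingElt ρbar μ σ := Iff.rfl

/-- **[BPPTVY, Prop. 2.3.14(b) (⇒) with Lemma 2.3.11 = Cor. 2.3.19 (⇐)]: a coboundary is never obstructing.**
If `μ(σ) = a - ρ̄(σ)aρ̄(σ)⁻¹` then `μ(σ)ρ̄(σ) = aρ̄(σ) - ρ̄(σ)a` has trace `0`.  (This is the direction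
used in the correctness proof of Algorithm 2.4.1 (pp. 1156–1157): the cocycle of a non-equivalent pair is obstructing.)
[cite: BrumerEtAl2019, Prop. 2.3.14(b) p. 1154 and Cor. 2.3.19 p. 1155] -/
theorem not_isObstructing_of_isDeviationCoboundary {ρbar : Γ →* GL n k} {μ : Γ → Matrix n n k}
    (h : IsDeviationCoboundary ρbar μ) : ¬ IsObstructing ρbar μ := by
  rintro ⟨σ, hσ⟩
  obtain ⟨a, ha⟩ := h
  apply hσ
  rw [ha σ]
  simp only [Matrix.sub_mul, Matrix.mul_assoc, Units.inv_mul, Matrix.mul_one]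
  rw [Matrix.trace_sub, Matrix.trace_mul_comm, sub_self]

/-- A cocycle takes values in `V ⊆ M_n(k)` (in [BPPTVY]: `V = 𝔤(𝔽_ℓ)`, the Lie algebra of the
algebraic group `G ⊆ GL_n` through which `ρ₁, ρ₂` factor, or `𝔤⁰`). [cite: BrumerEtAl2019, (2.3.2) p. 1153 and Lemma 2.3.20 p. 1156] -/
def ValuedIn (V : Set (Matrix n n k)) (μ : Γ → Matrix n n k) : Prop :=
  ∀ σ, μ σ ∈ V

end Cocycle

section Lie

variable {n : Type*} [Fintype n] [DecidableEq n] {k : Type*} [CommRing k]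

/-- `𝔰𝔭(J)(k) = {a ∈ M_n(k) : aᵀ J + J a = 0}`, the Lie algebra of `Sp(J)`; [BPPTVY, (5.1.2)]:
"`𝔰𝔭₄(𝔽₂) = {A ∈ M₄(𝔽₂) : Aᵀ J + J A = 0} ≃ 𝔽₂^10` where `J` is the anti-identity matrix".
[cite: BrumerEtAl2019, (5.1.2) p. 1173] -/
def spLie (J : Matrix n n k) : Set (Matrix n n k) :=
  {a | aᵀ * J + J * a = 0}

/-- `𝔤𝔰𝔭(J)(k) = {a : aᵀ J + J a = c J for some scalar c}`, the Lie algebra of `GSp(J)`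
(the `𝔤 = Lie(G)` of [BPPTVY, §2.3] for `G = GSp₄`). [cite: BrumerEtAl2019, §2.3 p. 1153 and (5.1.2) p. 1173] -/
def gspLie (J : Matrix n n k) : Set (Matrix n n k) :=
  {a | ∃ c : k, aᵀ * J + J * a = c • J}

omit [DecidableEq n] in
/-- Unfolding lemma for `spLie`. [cite: BrumerEtAl2019, (5.1.2) p. 1173] -/
theorem mem_spLie_iff (J a : Matrix n n k) : a ∈ spLie J ↔ aᵀ * J + J * a = 0 := Iff.rfl

omit [DecidableEq n] in
/-- Unfolding lemma for `gspLie`. [cite: BrumerEtAl2019, §2.3 p. 1153] -/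
theorem mem_gspLie_iff (J a : Matrix n n k) : a ∈ gspLie J ↔ ∃ c : k, aᵀ * J + J * a = c • J := Iff.rfl

omit [DecidableEq n] in
/-- `𝔰𝔭(J) ⊆ 𝔤𝔰𝔭(J)` (scalar `c = 0`). [folklore] -/
theorem spLie_subset_gspLie (J : Matrix n n k) : spLie J ⊆ gspLie J :=
  fun a ha => ⟨0, by rw [zero_smul]; exact ha⟩

/-- The anti-identity `4 × 4` matrix `J` (`1` along the anti-diagonal), the Gram matrix of the
symplectic form on `Z = U⁰/L ≃ 𝔽₂⁴` in the basis `e₁, …, e₄` of [BPPTVY, §5.1]. [cite: BrumerEtAl2019, §5.1 and (5.1.2) p. 1173] -/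
def antiId4 (k : Type*) [CommRing k] : Matrix (Fin 4) (Fin 4) k :=
  !![0, 0, 0, 1; 0, 0, 1, 0; 0, 1, 0, 0; 1, 0, 0, 0]

/-- The witness `a₀ = diag(1,1,0,0) ∈ M₄(𝔽₂)` for the divergence note below. [cite: BrumerEtAl2019, (5.1.2) p. 1173] -/
def diag1100 : Matrix (Fin 4) (Fin 4) (ZMod 2) :=
  Matrix.diagonal ![1, 1, 0, 0]

/-- DIVERGENCE from the printed text (recorded in the cell's DIVERGENCE.md): in characteristic `2`,
`a₀ = diag(1,1,0,0)` lies in `𝔤𝔰𝔭₄(𝔽₂)` (`a₀ᵀJ + Ja₀ = 1 • J`), has trace `0`, and is NOT in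
`𝔰𝔭₄(𝔽₂)`; so the trace-zero part `𝔤⁰` of `𝔤 = 𝔤𝔰𝔭₄(𝔽₂)` [BPPTVY, Lemma 2.3.20] is NOT `𝔰𝔭₄(𝔽₂)`,
contrary to the literal reading of (5.1.2) "`𝔤⁰(GSp₄)(𝔽₂) = 𝔰𝔭₄(𝔽₂)`".  The reduction to
`𝔰𝔭₄`-valued cocycles used in [BPPTVY, §§5–7] is instead a consequence of the equality of the
similitude characters of `ρ_{A,2}` and `ρ_{f,2}` (both cyclotomic, (4.1.3) p. 1164 and Thm. 4.3.4(ii) p. 1169), which is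
how `Criterion.lean` types it. [cite: BrumerEtAl2019, Lemma 2.3.20 p. 1156 and (5.1.2) p. 1173] -/
theorem gspLie_ne_spLie_char_two :
    diag1100 ∈ gspLie (antiId4 (ZMod 2)) ∧ Matrix.trace diag1100 = 0 ∧
      diag1100 ∉ spLie (antiId4 (ZMod 2)) := by
  refine ⟨⟨1, by unfold diag1100 antiId4; decide⟩, by unfold diag1100; decide, ?_⟩
  rw [mem_spLie_iff]
  unfold diag1100 antiId4
  decide

end Lie

end Literature.NumberTheory.FaltingsSerre
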